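import Literature.Analysis.FluidPDE.OseenTensorKernel
import Literature.Analysis.FluidPDE.HeatFlowDivPotential
import Literature.Analysis.FluidPDE.OseenHeatPairing
import HarnessLib

/-!
# `e^{τΔ}P G = ∫ 𝒪_τ(x - y) G(y) dy`: the Oseen tensor represents the projected heat flow of
# test fields

Analysis/FluidPDE proofs-layer companion (theorems only) of `OseenTensorKernel.lean`, for the
proof of the named fact
`Literature.Analysis.FluidPDE.bradshawGrujicKukavica2015_local_analyticity_radius`. For a test
field `G ∈ C_c^∞(ℝ³; ℝ³)`, `τ > 0` and every `x`,

  `heatExtension (classicalLerayProj G) τ x = ∫ y, oseenTensor τ (x - y) (G y)`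
  (`heatExtension_classicalLerayProj_eq_integral_oseenTensor`),

i.e. `e^{τΔ}P G (x) = ∫ 𝒪_τ(x - y) G(y) dy` with the Oseen tensor
`𝒪_τ(z)a = (G_τ(z) - A₁(τ,z))a + A(τ,z)⟪z,a⟫z` (Lemarié-Rieusset 2016, §6.2). Proof, component
by component (`a ∈ ℝ³`): `⟪e^{τΔ}PG(x), a⟫ = ⟪e^{τΔ}G(x), a⟫ + ∫_τ^∞ e^{sΔ}(∂ₐ div G)(x) ds`
(`HeatFlowDivPotential.inner_heatExtension_classicalLerayProj`); `div G = ∑ⱼ ∂ⱼGⱼ`, so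
`e^{sΔ}(∂ₐ div G) = ∑ⱼ ∂ₐ∂ⱼe^{sΔ}Gⱼ = ∑ⱼ ∫ ∂ₐ∂ⱼG_s(x-y) Gⱼ(y) dy` (`heatD2_eq_heatExtension`,
`heatD2_eq_integral_heatKernelHessWeight`); Fubini in `(s, y)` (the Hessian weight is dominated on
`(τ,∞) × supp G` by an integrable profile) and
`∫_τ^∞ ∂ₐ∂ⱼG_s(z) ds = -aⱼA₁(τ,z) + zⱼ⟪z,a⟫A(τ,z)` (`integral_Ioi_heatKernelHessWeight`).

## References

* P. G. Lemarié-Rieusset, *The Navier–Stokes Problem in the 21st Century* (2016), §6.2.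
  [LemarieRieusset2016]
* H. Koch, D. Tataru, Adv. Math. 157 (2001), §2 (6)–(8). [KochTataruAdvMath2001]
-/

noncomputable section

open MeasureTheory Set Function Filter Metric Real
open _root_.Topology
open scoped ENNReal InnerProductSpace RealInnerProductSpace ContDiff

namespace Literature.Analysis.FluidPDE

open UnboundedOperators (heatKernel heatExtension)

/-! ### Continuity of the Gaussian weights in space -/

section WeightContinuity

variable {E : Type*} [NormedAddCommGroup E] [InnerProductSpace ℝ E]

/-- **Continuity in space of the Gaussian moment integrals** `z ↦ ∫_τ^∞ G_s(z)/(c sᵏ) ds`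
(`τ > 0`, `c > 0`, `k ≥ 1`, positive dimension): dominated convergence under
`(4πs)^{-d/2}/(c sᵏ)`. [folklore] -/
theorem continuous_setIntegral_Ioi_heatKernel_div (hE : 0 < Module.finrank ℝ E) {τ : ℝ} (hτ : 0 < τ)
    {c : ℝ} (hc : 0 < c) {k : ℕ} (hk : 1 ≤ k) :
    Continuous fun z : E => ∫ s in Ioi τ, heatKernel s z / (c * s ^ k) := by
  set d : ℝ := (Module.finrank ℝ E : ℝ) with hd
  have hd0 : 0 < d := by rw [hd]; exact_mod_cast hE
  -- the majorant `s ↦ (4πs)^{-d/2} / (c s^k)` is integrable on `(τ, ∞)`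
  set m : ℝ → ℝ := fun s => (4 * π * s) ^ (-d / 2) / (c * s ^ k) with hm
  have hmeq : ∀ s ∈ Ioi τ, m s = (4 * π) ^ (-d / 2) / c * s ^ (-(d / 2 + k)) := by
    intro s hs
    have hs0 : 0 < s := hτ.trans hs
    rw [hm]
    simp only
    rw [Real.mul_rpow (by positivity) hs0.le, show -(d / 2 + k) = -d / 2 + -(k : ℝ) by ring,
      Real.rpow_add hs0, Real.rpow_neg hs0.le (k : ℝ), Real.rpow_natCast]
    field_simp
  have hmi : IntegrableOn m (Ioi τ) := by
    have hr : -(d / 2 + k) < -1 := by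
      have : (1 : ℝ) ≤ k := by exact_mod_cast hk
      linarith
    have h := (integrableOn_Ioi_rpow_of_lt hr hτ).const_mul ((4 * π) ^ (-d / 2) / c)
    exact IntegrableOn.congr_fun h (fun s hs => (hmeq s hs).symm) measurableSet_Ioi
  refine continuous_of_dominated (bound := m) ?_ ?_ hmi ?_
  · intro z
    refine ContinuousOn.aestronglyMeasurable ?_ measurableSet_Ioi
    refine ((continuousOn_heatKernel_time z).mono (Ioi_subset_Ioi hτ.le)).div (by fun_prop) ?_
    exact fun s hs => mul_ne_zero hc.ne' (pow_ne_zero _ (hτ.trans hs).ne')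
  · intro z
    refine (ae_restrict_iff' measurableSet_Ioi).2 (Eventually.of_forall fun s hs => ?_)
    have hs0 : 0 < s := hτ.trans hs
    rw [Real.norm_of_nonneg (div_nonneg (UnboundedOperators.heatKernel_pos hs0 z).le (by positivity)), hm]
    refine div_le_div_of_nonneg_right ?_ (by positivity)
    have := UnboundedOperators.heatKernel_le hs0 z
    rwa [← hd] at this
  · refine (ae_restrict_iff' measurableSet_Ioi).2 (Eventually.of_forall fun s hs => ?_)
    have hs0 : 0 < s := hτ.trans hs
    exact ((UnboundedOperators.continuous_heatKernel s).div_const _)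

/-- `z ↦ A(τ, z)` is continuous (`τ > 0`, positive dimension). [folklore] -/
theorem continuous_oseenWeightA (hE : 0 < Module.finrank ℝ E) {τ : ℝ} (hτ : 0 < τ) :
    Continuous fun z : E => oseenWeightA τ z :=
  continuous_setIntegral_Ioi_heatKernel_div hE hτ (by norm_num : (0 : ℝ) < 4) (by norm_num : 1 ≤ 2)

/-- `z ↦ A₁(τ, z)` is continuous (`τ > 0`, positive dimension). [folklore] -/
theorem continuous_oseenWeightA1 (hE : 0 < Module.finrank ℝ E) {τ : ℝ} (hτ : 0 < τ) :
    Continuous fun z : E => oseenWeightA1 τ z :=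
  continuous_setIntegral_Ioi_heatKernel_div hE hτ (by norm_num : (0 : ℝ) < 2) le_rfl

/-- **The Oseen tensor is continuous in space**, jointly with a continuous tensor slot:
`y ↦ 𝒪_τ(x - y) (G y)` is continuous for continuous `G` (`τ > 0`). [folklore] -/
theorem continuous_oseenTensor_sub_apply (hE : 0 < Module.finrank ℝ E) {τ : ℝ} (hτ : 0 < τ)
    {G : E → E} (hG : Continuous G) (x : E) :
    Continuous fun y : E => oseenTensor τ (x - y) (G y) := by
  have hz : Continuous fun y : E => x - y := continuous_const.sub continuous_id
  have h1 : Continuous fun y => heatKernel τ (x - y) - oseenWeightA1 τ (x - y) :=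
    ((UnboundedOperators.continuous_heatKernel τ).comp hz).sub ((continuous_oseenWeightA1 hE hτ).comp hz)
  have h2 : Continuous fun y => oseenWeightA τ (x - y) * ⟪x - y, G y⟫ :=
    ((continuous_oseenWeightA hE hτ).comp hz).mul (hz.inner hG)
  simp only [oseenTensor_apply]
  exact (h1.smul hG).add (h2.smul hz)

end WeightContinuity

/-! ### Coordinates on `ℝ³` -/

section Coordinates

variable {G : EuclideanSpace ℝ (Fin 3) → EuclideanSpace ℝ (Fin 3)}

/-- Coordinates of a Fréchet derivative are derivatives of coordinates (private copy of a tree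
one-liner of `LocalBiotSavartCalculus.lean`, not imported). [folklore] -/
private theorem fderiv_apply_coord' (hG : Differentiable ℝ G) (y v : EuclideanSpace ℝ (Fin 3)) (j : Fin 3) :
    (fderiv ℝ G y v) j = fderiv ℝ (fun z => G z j) y v := by
  have h := ((EuclideanSpace.proj (𝕜 := ℝ) j).hasFDerivAt.comp y (hG y).hasFDerivAt).fderiv
  rw [show (fun z => G z j) = (EuclideanSpace.proj (𝕜 := ℝ) j) ∘ G from rfl, h]
  rfl

/-- **`div G = ∑ⱼ ∂ⱼGⱼ`** in the standard coordinates of `ℝ³` (private copy of the tree's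
`divergence_eq_sum_fderiv_coord` of `TaoEnstrophyIdentity.lean`, not imported). [folklore] -/
private theorem divergence_eq_sum_fderiv_coord' (hG : Differentiable ℝ G) (y : EuclideanSpace ℝ (Fin 3)) :
    VectorCalculus.divergence G y =
      ∑ j, fderiv ℝ (fun z => G z j) y (EuclideanSpace.basisFun (Fin 3) ℝ j) := by
  rw [divergence_eq_sum_inner_fderiv (EuclideanSpace.basisFun (Fin 3) ℝ)]
  refine Finset.sum_congr rfl fun j _ => ?_
  rw [EuclideanSpace.basisFun_apply, EuclideanSpace.inner_single_left, map_one, one_mul,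
    ← EuclideanSpace.basisFun_apply, fderiv_apply_coord' hG]

/-- **`∂ₐ div G = ∑ⱼ ∂ₐ∂ⱼGⱼ`** for `G ∈ C²` (private copy of the tree's lemma of
`PressureGradientInterior.lean`, not imported). [folklore] -/
private theorem fderiv_divergence_apply_eq_sum' (hG : ContDiff ℝ 2 G) (y a : EuclideanSpace ℝ (Fin 3)) :
    fderiv ℝ (VectorCalculus.divergence G) y a =
      ∑ j, fderiv ℝ (fun z => fderiv ℝ (fun w => G w j) z (EuclideanSpace.basisFun (Fin 3) ℝ j)) y a := by
  have hGd : Differentiable ℝ G := hG.differentiable (by norm_num)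
  have hcoord : ∀ j, ContDiff ℝ 2 fun w => G w j := fun j =>
    (EuclideanSpace.proj (𝕜 := ℝ) j).contDiff.comp hG
  have hdj : ∀ j, Differentiable ℝ fun z => fderiv ℝ (fun w => G w j) z (EuclideanSpace.basisFun (Fin 3) ℝ j) :=
    fun j => (contDiff_fderiv_apply_const_of_succ (n := 1) (hcoord j) _).differentiable one_ne_zero
  have hdiv : VectorCalculus.divergence G = fun y =>
      ∑ j, fderiv ℝ (fun z => G z j) y (EuclideanSpace.basisFun (Fin 3) ℝ j) :=
    funext (divergence_eq_sum_fderiv_coord' hGd)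
  rw [hdiv, (HasFDerivAt.fun_sum fun j _ => ((hdj j) y).hasFDerivAt).fderiv,
    FunLike.coe_sum, Finset.sum_apply]

/-- `∑ⱼ aⱼ vⱼ = ⟪a, v⟫` on `ℝ³`. [folklore] -/
theorem sum_coord_mul_coord (a v : EuclideanSpace ℝ (Fin 3)) : ∑ j, a j * v j = ⟪a, v⟫ := by
  simp [PiLp.inner_apply, mul_comm]

end Coordinates

/-! ### The heat flow of `∂ₐ div G` through the Hessian weight -/

section HessianFlow

variable {G : EuclideanSpace ℝ (Fin 3) → EuclideanSpace ℝ (Fin 3)}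

/-- The coordinate functions of a test field are test functions. [folklore] -/
theorem contDiff_coord_fin3 (hG : ContDiff ℝ ∞ G) (j : Fin 3) : ContDiff ℝ ∞ fun w => G w j :=
  (EuclideanSpace.proj (𝕜 := ℝ) j).contDiff.comp hG

/-- The coordinate functions of a compactly supported field have compact support. [folklore] -/
theorem hasCompactSupport_coord_fin3 (hGc : HasCompactSupport G) (j : Fin 3) :
    HasCompactSupport fun w => G w j :=
  hGc.mono' fun w hw => by
    by_contra h
    exact hw (by simp [image_eq_zero_of_notMem_tsupport h])

/-- **`e^{sΔ}(∂ₐ div G)(x) = ∑ⱼ ∫ ∂ₐ∂ⱼG_s(x - y) Gⱼ(y) dy`** for a test field `G` and `s > 0`.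
[cite: Folland1995PDE, §4.A Theorem (4.3)] -/
theorem heatExtension_fderiv_divergence_eq_sum_integral (hG : ContDiff ℝ ∞ G) (hGc : HasCompactSupport G)
    {s : ℝ} (hs : 0 < s) (x a : EuclideanSpace ℝ (Fin 3)) :
    heatExtension (fun y => fderiv ℝ (VectorCalculus.divergence G) y a) s x =
      ∑ j, ∫ y, heatKernelHessWeight s a (EuclideanSpace.basisFun (Fin 3) ℝ j) (x - y) * G y j := by
  set e := EuclideanSpace.basisFun (Fin 3) ℝ with he
  -- the summands `gⱼ = ∂ₐ∂ⱼGⱼ` and their heat flows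
  set g : Fin 3 → EuclideanSpace ℝ (Fin 3) → ℝ := fun j y =>
    fderiv ℝ (fun z => fderiv ℝ (fun w => G w j) z (e j)) y a with hg
  have hG2 : ContDiff ℝ 2 G := hG.of_le (by norm_cast)
  have hcoord2 : ∀ j, ContDiff ℝ 2 fun w => G w j := fun j => (contDiff_coord_fin3 hG j).of_le (by norm_cast)
  have hgc : ∀ j, Continuous (g j) := fun j => by
    have h1 : ContDiff ℝ 1 fun z => fderiv ℝ (fun w => G w j) z (e j) :=
      contDiff_fderiv_apply_const_of_succ (n := 1) (hcoord2 j) _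
    exact (h1.continuous_fderiv one_ne_zero).clm_apply continuous_const
  have hgs : ∀ j, HasCompactSupport (g j) := fun j =>
    ((hasCompactSupport_coord_fin3 hGc j).fderiv_apply (𝕜 := ℝ) (e j)).fderiv_apply (𝕜 := ℝ) a
  -- `e^{sΔ}(∑ gⱼ) = ∑ e^{sΔ} gⱼ`
  have hsum : (fun y => fderiv ℝ (VectorCalculus.divergence G) y a) = fun y => ∑ j, g j y :=
    funext fun y => fderiv_divergence_apply_eq_sum' hG2 y a
  rw [hsum, UnboundedOperators.heatExtension_apply]
  have hint : ∀ j, Integrable fun y => heatKernel s y • g j (x - y) := fun j =>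
    UnboundedOperators.integrable_heatKernel_smul_of_bound (hgc j)
      (fun z => (hgc j).norm.bddAbove_range_of_hasCompactSupport (hgs j).norm |>.choose_spec
        (mem_range_self z)) hs x
  have hswap : ∫ y, heatKernel s y • ∑ j, g j (x - y) = ∑ j, ∫ y, heatKernel s y • g j (x - y) := by
    rw [← integral_finsetSum _ fun j _ => hint j]
    refine integral_congr_ae (Eventually.of_forall fun y => ?_)
    simp only [Finset.smul_sum]
  rw [hswap]
  refine Finset.sum_congr rfl fun j _ => ?_
  -- `e^{sΔ}gⱼ = heatD2 s a eⱼ Gⱼ = ∫ ∂ₐ∂ⱼG_s(x-y) Gⱼ(y) dy`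
  have h1 : ∫ y, heatKernel s y • g j (x - y) = heatExtension (g j) s x :=
    (UnboundedOperators.heatExtension_apply _ _ _).symm
  have h2 : heatExtension (g j) s = heatD2 s a (e j) (fun w => G w j) :=
    (heatD2_eq_heatExtension (hcoord2 j) (hasCompactSupport_coord_fin3 hGc j) s (e j) a).symm
  have hmem : MemLp (fun w => G w j) 1 (volume : Measure (EuclideanSpace ℝ (Fin 3))) :=
    memLp_one_iff_integrable.2 ((contDiff_coord_fin3 hG j).continuous.integrable_of_hasCompactSupport
      (hasCompactSupport_coord_fin3 hGc j))
  rw [h1, h2, heatD2_eq_integral_heatKernelHessWeight hmem le_rfl hs a (e j) x]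

end HessianFlow

/-! ### Fubini for the Hessian weight against a test function -/

section Fubini

/-- **Pointwise bound for the Hessian weight**:
`|∂ᵥ∂_cG_s(z)| ≤ (‖v‖‖c‖/(2s) + ‖z‖²‖c‖‖v‖/(4s²)) G_s(z)` (`s > 0`). [folklore] -/
theorem abs_heatKernelHessWeight_le {E : Type*} [NormedAddCommGroup E] [InnerProductSpace ℝ E]
    {s : ℝ} (hs : 0 < s) (v c z : E) :
    |heatKernelHessWeight s v c z| ≤
      (‖v‖ * ‖c‖ / (2 * s) + ‖z‖ ^ 2 * ‖c‖ * ‖v‖ / (4 * s ^ 2)) * heatKernel s z := by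
  have hG0 := (UnboundedOperators.heatKernel_pos hs z).le
  rw [heatKernelHessWeight_eq, pow_one]
  refine (abs_add_le _ _).trans ?_
  rw [abs_mul, abs_mul, abs_neg, abs_of_nonneg (div_nonneg hG0 (by positivity)),
    abs_of_nonneg (div_nonneg hG0 (by positivity)), abs_mul]
  have h1 : |⟪v, c⟫| ≤ ‖v‖ * ‖c‖ := abs_real_inner_le_norm v c
  have h2 : |⟪z, c⟫| * |⟪z, v⟫| ≤ ‖z‖ ^ 2 * ‖c‖ * ‖v‖ := by
    calc |⟪z, c⟫| * |⟪z, v⟫| ≤ (‖z‖ * ‖c‖) * (‖z‖ * ‖v‖) :=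
          mul_le_mul (abs_real_inner_le_norm z c) (abs_real_inner_le_norm z v) (abs_nonneg _) (by positivity)
      _ = ‖z‖ ^ 2 * ‖c‖ * ‖v‖ := by ring
  calc |⟪v, c⟫| * (heatKernel s z / (2 * s)) + |⟪z, c⟫| * |⟪z, v⟫| * (heatKernel s z / (4 * s ^ 2))
      ≤ ‖v‖ * ‖c‖ * (heatKernel s z / (2 * s)) + ‖z‖ ^ 2 * ‖c‖ * ‖v‖ * (heatKernel s z / (4 * s ^ 2)) := by
        gcongr
    _ = (‖v‖ * ‖c‖ / (2 * s) + ‖z‖ ^ 2 * ‖c‖ * ‖v‖ / (4 * s ^ 2)) * heatKernel s z := by ring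

/-- **The Hessian weight is jointly continuous in `(s, z)` on `s > 0`.** [folklore] -/
theorem continuousOn_heatKernelHessWeight_uncurry {E : Type*} [NormedAddCommGroup E]
    [InnerProductSpace ℝ E] (v c : E) :
    ContinuousOn (fun q : ℝ × E => heatKernelHessWeight q.1 v c q.2) (Ioi 0 ×ˢ univ) := by
  have hK : ContinuousOn (fun q : ℝ × E => heatKernel q.1 q.2) (Ioi (0 : ℝ) ×ˢ univ) :=
    (UnboundedOperators.contDiffOn_uncurry_heatKernel (E := E) (m := 0)).continuousOn
  have hpoly : ContinuousOn (fun q : ℝ × E => -(1 / (2 * q.1)) * ⟪v, c⟫ +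
      (1 / (2 * q.1)) ^ 2 * (⟪q.2, c⟫ * ⟪q.2, v⟫)) (Ioi (0 : ℝ) ×ˢ univ) := by
    have h1 : ContinuousOn (fun q : ℝ × E => 1 / (2 * q.1)) (Ioi (0 : ℝ) ×ˢ univ) :=
      continuousOn_const.div (by fun_prop) fun q hq => mul_ne_zero two_ne_zero (ne_of_gt hq.1)
    exact ((h1.neg).mul continuousOn_const).add ((h1.pow 2).mul
      (((continuous_snd.inner continuous_const).mul (continuous_snd.inner continuous_const)).continuousOn))
  unfold heatKernelHessWeight
  exact hpoly.mul hK

variable {G : EuclideanSpace ℝ (Fin 3) → EuclideanSpace ℝ (Fin 3)}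

/-- **Integrability of `(s, y) ↦ ∂ₐ∂_cG_s(x - y) g(y)` on `(τ, ∞) × ℝ³`** for a continuous compactly
supported scalar `g` and `τ > 0` (majorant: a power profile in `s` times `|g|`). [folklore] -/
theorem integrable_heatKernelHessWeight_mul_prod {g : EuclideanSpace ℝ (Fin 3) → ℝ} (hg : Continuous g)
    (hgc : HasCompactSupport g) {τ : ℝ} (hτ : 0 < τ) (a c x : EuclideanSpace ℝ (Fin 3)) :
    Integrable (fun p : ℝ × EuclideanSpace ℝ (Fin 3) => heatKernelHessWeight p.1 a c (x - p.2) * g p.2)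
      (((volume : Measure ℝ).restrict (Ioi τ)).prod (volume : Measure (EuclideanSpace ℝ (Fin 3)))) := by
  set μ : Measure (ℝ × EuclideanSpace ℝ (Fin 3)) :=
    ((volume : Measure ℝ).restrict (Ioi τ)).prod (volume : Measure (EuclideanSpace ℝ (Fin 3))) with hμ
  -- a radius for the support and the resulting profile in `s`
  obtain ⟨R₀, hR₀⟩ : ∃ R : ℝ, tsupport g ⊆ closedBall (0 : EuclideanSpace ℝ (Fin 3)) R :=
    (hgc.isCompact.isBounded).subset_closedBall 0
  set R : ℝ := ‖x‖ + |R₀| with hR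
  set m : ℝ → ℝ := fun s => (‖a‖ * ‖c‖ / (2 * s) + R ^ 2 * ‖c‖ * ‖a‖ / (4 * s ^ 2)) *
    (4 * π * s) ^ (-(3 : ℝ) / 2) with hm
  -- the majorant is integrable
  have hmi : IntegrableOn m (Ioi τ) := by
    have e1 : ∀ s ∈ Ioi τ, m s = ‖a‖ * ‖c‖ / 2 * (4 * π) ^ (-(3 : ℝ) / 2) * s ^ (-(5 : ℝ) / 2) +
        R ^ 2 * ‖c‖ * ‖a‖ / 4 * (4 * π) ^ (-(3 : ℝ) / 2) * s ^ (-(7 : ℝ) / 2) := by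
      intro s hs
      have hs0 : 0 < s := hτ.trans hs
      rw [hm]
      simp only
      rw [Real.mul_rpow (by positivity) hs0.le,
        show (-(5 : ℝ) / 2) = -1 + -(3 : ℝ) / 2 by norm_num,
        show (-(7 : ℝ) / 2) = -2 + -(3 : ℝ) / 2 by norm_num, Real.rpow_add hs0, Real.rpow_add hs0,
        Real.rpow_neg hs0.le 1, Real.rpow_neg hs0.le 2, Real.rpow_one,
        show s ^ (2 : ℝ) = s ^ 2 by exact_mod_cast Real.rpow_natCast s 2]
      field_simp
    have h5 := (integrableOn_Ioi_rpow_of_lt (show -(5 : ℝ) / 2 < -1 by norm_num) hτ).const_mul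
      (‖a‖ * ‖c‖ / 2 * (4 * π) ^ (-(3 : ℝ) / 2))
    have h7 := (integrableOn_Ioi_rpow_of_lt (show -(7 : ℝ) / 2 < -1 by norm_num) hτ).const_mul
      (R ^ 2 * ‖c‖ * ‖a‖ / 4 * (4 * π) ^ (-(3 : ℝ) / 2))
    exact IntegrableOn.congr_fun (h5.add h7) (fun s hs => (e1 s hs).symm) measurableSet_Ioi
  have hbound : Integrable (fun p : ℝ × EuclideanSpace ℝ (Fin 3) => m p.1 * |g p.2|) μ :=
    hmi.mul_prod (hg.integrable_of_hasCompactSupport hgc).abs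
  -- measurability: continuity on `(τ, ∞) × ℝ³`
  have hcont : ContinuousOn (fun p : ℝ × EuclideanSpace ℝ (Fin 3) =>
      heatKernelHessWeight p.1 a c (x - p.2) * g p.2) (Ioi τ ×ˢ univ) := by
    have hmap : Continuous fun p : ℝ × EuclideanSpace ℝ (Fin 3) =>
        ((p.1, x - p.2) : ℝ × EuclideanSpace ℝ (Fin 3)) := by fun_prop
    have h1 := (continuousOn_heatKernelHessWeight_uncurry a c).comp
      (hmap.continuousOn (s := Ioi τ ×ˢ (univ : Set (EuclideanSpace ℝ (Fin 3)))))
      (fun p hp => ⟨hτ.trans (mem_prod.1 hp).1, mem_univ _⟩)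
    exact h1.mul (hg.comp continuous_snd).continuousOn
  have hmeas : AEStronglyMeasurable (fun p : ℝ × EuclideanSpace ℝ (Fin 3) =>
      heatKernelHessWeight p.1 a c (x - p.2) * g p.2) μ := by
    have h := hcont.aestronglyMeasurable (μ := (volume : Measure (ℝ × EuclideanSpace ℝ (Fin 3))))
      (measurableSet_Ioi.prod MeasurableSet.univ)
    have e : μ = (volume : Measure (ℝ × EuclideanSpace ℝ (Fin 3))).restrict (Ioi τ ×ˢ univ) := by
      rw [hμ, Measure.volume_eq_prod, ← Measure.restrict_univ (μ := (volume : Measure (EuclideanSpace ℝ (Fin 3)))),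
        Measure.prod_restrict, Measure.restrict_univ]
    rw [e]
    exact h
  refine hbound.mono' hmeas ?_
  -- the pointwise domination, a.e. (`s > τ`)
  have hae : ∀ᵐ p ∂μ, p.1 ∈ Ioi τ := by
    refine (Measure.quasiMeasurePreserving_fst (μ := (volume : Measure ℝ).restrict (Ioi τ))
      (ν := (volume : Measure (EuclideanSpace ℝ (Fin 3))))).ae ?_
    exact ae_restrict_mem measurableSet_Ioi
  filter_upwards [hae] with p hp
  have hs0 : 0 < p.1 := hτ.trans hp
  rw [norm_mul, Real.norm_eq_abs, Real.norm_eq_abs]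
  by_cases hy : g p.2 = 0
  · simp [hy]
  · have hys : p.2 ∈ closedBall (0 : EuclideanSpace ℝ (Fin 3)) R₀ := hR₀ (subset_tsupport _ (Function.mem_support.2 hy))
    have hz : ‖x - p.2‖ ≤ R := by
      calc ‖x - p.2‖ ≤ ‖x‖ + ‖p.2‖ := norm_sub_le _ _
        _ ≤ ‖x‖ + |R₀| := by
            have : ‖p.2‖ ≤ R₀ := by simpa using hys
            linarith [le_abs_self R₀]
    refine mul_le_mul_of_nonneg_right ?_ (abs_nonneg _)
    refine (abs_heatKernelHessWeight_le hs0 a c (x - p.2)).trans ?_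
    have hG := UnboundedOperators.heatKernel_le hs0 (x - p.2)
    rw [finrank_euclideanSpace_fin, show (-((3 : ℕ) : ℝ)) / 2 = -(3 : ℝ) / 2 by norm_num] at hG
    rw [hm]
    refine mul_le_mul ?_ hG (UnboundedOperators.heatKernel_pos hs0 _).le (by positivity)
    gcongr

end Fubini

/-! ### The representation -/

section Representation

variable {G : EuclideanSpace ℝ (Fin 3) → EuclideanSpace ℝ (Fin 3)}

/-- **The time integral of the heat flow of `∂ₐ div G` through the weights**: for a test field `G`,
`τ > 0`, `∫_τ^∞ e^{sΔ}(∂ₐ div G)(x) ds = ∑ⱼ ∫ (-aⱼ A₁(τ, x-y) + (x-y)ⱼ ⟪x-y, a⟫ A(τ, x-y)) Gⱼ(y) dy`.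
[cite: LemarieRieusset2016, §6.2] -/
theorem integral_Ioi_heatExtension_fderiv_divergence_eq (hG : ContDiff ℝ ∞ G) (hGc : HasCompactSupport G)
    {τ : ℝ} (hτ : 0 < τ) (x a : EuclideanSpace ℝ (Fin 3)) :
    ∫ s in Ioi τ, heatExtension (fun y => fderiv ℝ (VectorCalculus.divergence G) y a) s x =
      ∑ j, ∫ y, (-(a j) * oseenWeightA1 τ (x - y) +
        (x - y) j * ⟪x - y, a⟫ * oseenWeightA τ (x - y)) * G y j := by
  have hE : 0 < Module.finrank ℝ (EuclideanSpace ℝ (Fin 3)) := by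
    rw [finrank_euclideanSpace_fin]; norm_num
  set e := EuclideanSpace.basisFun (Fin 3) ℝ with he
  set F : Fin 3 → ℝ × EuclideanSpace ℝ (Fin 3) → ℝ := fun j p =>
    heatKernelHessWeight p.1 a (e j) (x - p.2) * G p.2 j with hF
  have hFi : ∀ j, Integrable (F j) (((volume : Measure ℝ).restrict (Ioi τ)).prod
      (volume : Measure (EuclideanSpace ℝ (Fin 3)))) := fun j =>
    integrable_heatKernelHessWeight_mul_prod (contDiff_coord_fin3 hG j).continuous
      (hasCompactSupport_coord_fin3 hGc j) hτ a (e j) x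
  -- rewrite the time integrand on `(τ, ∞)`
  have hrw : ∫ s in Ioi τ, heatExtension (fun y => fderiv ℝ (VectorCalculus.divergence G) y a) s x =
      ∫ s in Ioi τ, ∑ j, ∫ y, F j (s, y) := by
    refine setIntegral_congr_fun measurableSet_Ioi fun s hs => ?_
    exact heatExtension_fderiv_divergence_eq_sum_integral hG hGc (hτ.trans hs) x a
  rw [hrw, integral_finsetSum _ fun j _ => (hFi j).integral_prod_left]
  refine Finset.sum_congr rfl fun j _ => ?_
  rw [integral_integral_swap (hFi j)]
  refine integral_congr_ae (Eventually.of_forall fun y => ?_)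
  show ∫ s in Ioi τ, heatKernelHessWeight s a (e j) (x - y) * G y j = _
  rw [integral_mul_const, (integral_Ioi_heatKernelHessWeight hE hτ a (e j) (x - y)).2]
  have h1 : ⟪a, e j⟫ = a j := by
    rw [he, EuclideanSpace.basisFun_apply, real_inner_comm, EuclideanSpace.inner_single_left, map_one, one_mul]
  have h2 : ⟪x - y, e j⟫ = (x - y) j := by
    rw [he, EuclideanSpace.basisFun_apply, real_inner_comm, EuclideanSpace.inner_single_left, map_one, one_mul]
  rw [h1, h2]

/-- **Components of `e^{τΔ}P G` through the Oseen tensor**: for a test field `G`, `τ > 0`,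
`⟪e^{τΔ}PG(x), a⟫ = ∫ ⟪𝒪_τ(x - y) G(y), a⟫ dy`. [cite: LemarieRieusset2016, §6.2] -/
theorem inner_heatExtension_classicalLerayProj_eq_integral_oseenTensor (hG : ContDiff ℝ ∞ G)
    (hGc : HasCompactSupport G) {τ : ℝ} (hτ : 0 < τ) (x a : EuclideanSpace ℝ (Fin 3)) :
    ⟪heatExtension (classicalLerayProj G) τ x, a⟫ = ∫ y, ⟪oseenTensor τ (x - y) (G y), a⟫ := by
  have hE : 0 < Module.finrank ℝ (EuclideanSpace ℝ (Fin 3)) := by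
    rw [finrank_euclideanSpace_fin]; norm_num
  have hGcont : Continuous G := hG.continuous
  rw [inner_heatExtension_classicalLerayProj hG hGc hτ x a,
    integral_Ioi_heatExtension_fderiv_divergence_eq hG hGc hτ x a]
  -- the free part: `⟪e^{τΔ}G(x), a⟫ = ∫ G_τ(x-y) ⟪G y, a⟫ dy`
  have hfree_int : Integrable fun y => heatKernel τ (x - y) • G y := by
    refine ((((UnboundedOperators.continuous_heatKernel τ).comp (continuous_const.sub continuous_id)).smul
      hGcont).integrable_of_hasCompactSupport ?_)
    exact hGc.mono' fun y hy => by
      by_contra h; exact hy (by simp [image_eq_zero_of_notMem_tsupport h])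
  have hfree : ⟪heatExtension G τ x, a⟫ = ∫ y, heatKernel τ (x - y) * ⟪G y, a⟫ := by
    rw [UnboundedOperators.heatExtension_eq_integral_sub, real_inner_comm, ← integral_inner hfree_int]
    refine integral_congr_ae (Eventually.of_forall fun y => ?_)
    show ⟪a, heatKernel τ (x - y) • G y⟫ = heatKernel τ (x - y) * ⟪G y, a⟫
    rw [inner_smul_right, real_inner_comm]
  -- integrability of the `y`-integrands (continuous, compactly supported)
  have hsupp : ∀ {f : EuclideanSpace ℝ (Fin 3) → ℝ}, (∀ y, G y = 0 → f y = 0) → Continuous f → Integrable f := by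
    intro f h0 hf
    refine hf.integrable_of_hasCompactSupport (hGc.mono' fun y hy => ?_)
    by_contra h
    exact hy (h0 y (image_eq_zero_of_notMem_tsupport h))
  have hA1c := continuous_oseenWeightA1 hE hτ
  have hAc := continuous_oseenWeightA hE hτ
  have hz : Continuous fun y : EuclideanSpace ℝ (Fin 3) => x - y := continuous_const.sub continuous_id
  have icoord : ∀ j, Integrable fun y => (-(a j) * oseenWeightA1 τ (x - y) +
      (x - y) j * ⟪x - y, a⟫ * oseenWeightA τ (x - y)) * G y j := by
    intro j
    refine hsupp (fun y hy => by simp [hy]) ?_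
    refine Continuous.mul ?_ ((EuclideanSpace.proj (𝕜 := ℝ) j).continuous.comp hGcont)
    exact ((continuous_const.mul (hA1c.comp hz)).add
      ((((EuclideanSpace.proj (𝕜 := ℝ) j).continuous.comp hz).mul (hz.inner continuous_const)).mul
        (hAc.comp hz)))
  have ifree : Integrable fun y => heatKernel τ (x - y) * ⟪G y, a⟫ :=
    hsupp (fun y hy => by simp [hy]) (((UnboundedOperators.continuous_heatKernel τ).comp hz).mul
      (hGcont.inner continuous_const))
  have isum : Integrable fun y => ∑ j, (-(a j) * oseenWeightA1 τ (x - y) +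
      (x - y) j * ⟪x - y, a⟫ * oseenWeightA τ (x - y)) * G y j :=
    integrable_finsetSum _ fun j _ => icoord j
  rw [hfree, ← integral_finsetSum _ fun j _ => icoord j, ← integral_add ifree isum]
  refine integral_congr_ae (Eventually.of_forall fun y => ?_)
  -- pointwise algebra
  set z := x - y with hzdef
  have hsum1 : ∑ j, -(a j) * oseenWeightA1 τ z * G y j = -(oseenWeightA1 τ z * ⟪a, G y⟫) := by
    rw [← sum_coord_mul_coord, Finset.mul_sum, ← Finset.sum_neg_distrib]
    refine Finset.sum_congr rfl fun j _ => by ring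
  have hsum2 : ∑ j, z j * ⟪z, a⟫ * oseenWeightA τ z * G y j = oseenWeightA τ z * ⟪z, a⟫ * ⟪z, G y⟫ := by
    rw [← sum_coord_mul_coord z (G y), Finset.mul_sum]
    refine Finset.sum_congr rfl fun j _ => by ring
  show heatKernel τ z * ⟪G y, a⟫ + ∑ j, (-(a j) * oseenWeightA1 τ z + z j * ⟪z, a⟫ * oseenWeightA τ z) * G y j =
    ⟪oseenTensor τ z (G y), a⟫
  rw [inner_oseenTensor]
  have hsplit : ∑ j, (-(a j) * oseenWeightA1 τ z + z j * ⟪z, a⟫ * oseenWeightA τ z) * G y j =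
      ∑ j, -(a j) * oseenWeightA1 τ z * G y j + ∑ j, z j * ⟪z, a⟫ * oseenWeightA τ z * G y j := by
    rw [← Finset.sum_add_distrib]
    refine Finset.sum_congr rfl fun j _ => by ring
  rw [hsplit, hsum1, hsum2, real_inner_comm (G y) a, real_inner_comm (G y) z]
  ring

/-- Integrability of `y ↦ 𝒪_τ(x - y) G(y)` for a continuous compactly supported field. [folklore] -/
theorem integrable_oseenTensor_sub_apply {τ : ℝ} (hτ : 0 < τ) (hG : Continuous G)
    (hGc : HasCompactSupport G) (x : EuclideanSpace ℝ (Fin 3)) :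
    Integrable fun y => oseenTensor τ (x - y) (G y) := by
  have hE : 0 < Module.finrank ℝ (EuclideanSpace ℝ (Fin 3)) := by
    rw [finrank_euclideanSpace_fin]; norm_num
  refine (continuous_oseenTensor_sub_apply hE hτ hG x).integrable_of_hasCompactSupport ?_
  exact hGc.mono' fun y hy => by
    by_contra h
    exact hy (by simp [image_eq_zero_of_notMem_tsupport h])

/-- **The Oseen tensor represents the projected heat flow of test fields**: for
`G ∈ C_c^∞(ℝ³; ℝ³)` and `τ > 0`, `e^{τΔ}P G (x) = ∫ 𝒪_τ(x - y) G(y) dy`. [cite: LemarieRieusset2016, §6.2] -/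
theorem heatExtension_classicalLerayProj_eq_integral_oseenTensor (hG : ContDiff ℝ ∞ G)
    (hGc : HasCompactSupport G) {τ : ℝ} (hτ : 0 < τ) (x : EuclideanSpace ℝ (Fin 3)) :
    heatExtension (classicalLerayProj G) τ x = ∫ y, oseenTensor τ (x - y) (G y) := by
  refine ext_inner_right ℝ fun a => ?_
  rw [inner_heatExtension_classicalLerayProj_eq_integral_oseenTensor hG hGc hτ x a,
    ← real_inner_comm, ← integral_inner (integrable_oseenTensor_sub_apply hτ hG.continuous hGc x)]
  exact integral_congr_ae (Eventually.of_forall fun y => real_inner_comm _ _)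

end Representation

end Literature.Analysis.FluidPDE
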